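import Summits.QuantumAdvantage.AdviceFreeQNC0.JointRelativeElimination
import HarnessLib

/-!
# Cell qa-qnc0 (rung F-Q1, route RingFrame, crux α): joint elimination against the residues of
# THREE blocks

`tripleElimHard` — there are `η₂, c > 0` such that for every `C`, all large blocks `L₀, L₁, L₂`,
every degree `D ≤ (log₂ L₀)^C` with `2D ≤ c√L₁`, `2D ≤ c√L₂`, every six polynomials
`a₀, b₀, a₁, b₁, a₂, b₂ ∈ lowDeg 𝔽₂ (L₀ + (L₁ + L₂)) D` and decoders `dec₀, dec₁, dec₂`: on at least
`η₂·2^{L₀+L₁+L₂}` inputs `u = x ++ (z₁ ++ z₂)` all three decoders name the true residues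
`|x|, |z₁|, |z₂| (mod 3)`.  Proof: fibrewise `elimHard` on the first block; Markov over the rows
`x`; in a good row the first event is a union of `≤ 4` level sets of `(a₀, b₀)(x, ·)`, one of
density `≥ η₀/10` in the `(L₁ + L₂)`-cube, on which the RELATIVE two-block theorem
`jointElimHard_relative` for `(a₁, b₁, a₂, b₂)(x, ·)` gives the other two events.  This is the
`t = 2` level of the induction "`(t+1)`-block joint elimination" behind the interior-cluster
special cases of the crux α (two interior windows need three unknown block residues).

The cell's statement (prover); not in print.  WHAT THIS IS NOT: the ring-game statement for two
interior windows (27-cell parity obstruction + decoder) is not in this file; nothing on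
`LDMAPolylog`, `TRPlus` or α in general; no separation.

## References

* S. Srinivasan, *A robust version of Hegedűs's lemma, with applications*, TheoretiCS 2 (2023),
  Lemma 3.1 [Srinivasan2023].
-/

noncomputable section

namespace Summit.QuantumAdvantage.AdviceFreeQNC0

open Finset
open Literature.Computability.MetaComplexity Literature.Computability.MetaComplexity.Smolensky
open Literature.Computability.MetaComplexity.Hegedus

/-- Over `𝔽₂`: `x + α + 1 ≠ 0 ↔ x = α`. [folklore] -/
private theorem zmod2_add_add_one_ne_zero_iff4 (x α : ZMod 2) : x + α + 1 ≠ 0 ↔ x = α := by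
  revert x α; decide

variable {L₀ L₁ L₂ : ℕ}

/-- **Joint elimination hardness, three blocks.**  There are `η₂, c > 0` such that for every `C`,
all large `L₀, L₁, L₂`, every `D ≤ (log₂ L₀)^C` with `2D ≤ c√L₁`, `2D ≤ c√L₂`, every
`a₀, b₀, a₁, b₁, a₂, b₂ ∈ lowDeg 𝔽₂ (L₀ + (L₁ + L₂)) D` and every three decoders, on at least
`η₂·2^{L₀+(L₁+L₂)}` inputs `u = x ++ (z₁ ++ z₂)` one has `dec₀(a₀ u, b₀ u) ≡ |x|`,
`dec₁(a₁ u, b₁ u) ≡ |z₁|` and `dec₂(a₂ u, b₂ u) ≡ |z₂| (mod 3)`. (Cell statement; fibrewise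
`elimHard` + Markov + `jointElimHard_relative` on a dense level set.)
[cite: Srinivasan2023, Lemma 3.1] -/
theorem tripleElimHard :
    ∃ η₂ : ℝ, 0 < η₂ ∧ ∃ c : ℝ, 0 < c ∧ ∀ C : ℕ, ∃ M₀ : ℕ, ∀ L₀ L₁ L₂ : ℕ,
      M₀ ≤ L₀ → M₀ ≤ L₁ → M₀ ≤ L₂ → ∀ D : ℕ, D ≤ (Nat.log 2 L₀) ^ C →
      ((D + D : ℕ) : ℝ) ≤ c * Real.sqrt L₁ → ((D + D : ℕ) : ℝ) ≤ c * Real.sqrt L₂ →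
      ∀ a₀ b₀ a₁ b₁ a₂ b₂ : CubeFn (ZMod 2) (L₀ + (L₁ + L₂)),
        a₀ ∈ lowDeg (ZMod 2) (L₀ + (L₁ + L₂)) D → b₀ ∈ lowDeg (ZMod 2) (L₀ + (L₁ + L₂)) D →
        a₁ ∈ lowDeg (ZMod 2) (L₀ + (L₁ + L₂)) D → b₁ ∈ lowDeg (ZMod 2) (L₀ + (L₁ + L₂)) D →
        a₂ ∈ lowDeg (ZMod 2) (L₀ + (L₁ + L₂)) D → b₂ ∈ lowDeg (ZMod 2) (L₀ + (L₁ + L₂)) D →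
          ∀ dec₀ dec₁ dec₂ : ZMod 2 → ZMod 2 → ℕ,
            η₂ * (2 : ℝ) ^ (L₀ + (L₁ + L₂)) ≤ ((univ.filter fun u : Fin (L₀ + (L₁ + L₂)) → Bool =>
              dec₀ (a₀ u) (b₀ u) % 3 = wt (fun i : Fin L₀ => u (Fin.castAdd (L₁ + L₂) i)) % 3 ∧
              dec₁ (a₁ u) (b₁ u) % 3 =
                wt (fun j : Fin L₁ => u (Fin.natAdd L₀ (Fin.castAdd L₂ j))) % 3 ∧
              dec₂ (a₂ u) (b₂ u) % 3 =
                wt (fun j : Fin L₂ => u (Fin.natAdd L₀ (Fin.natAdd L₁ j))) % 3).card : ℝ) := by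
  classical
  obtain ⟨η₀, hη₀, hE⟩ := elimHard
  obtain ⟨η', hη', c', hc', M', hR⟩ := jointElimHard_relative (η₀ / 10) (by positivity)
  refine ⟨η₀ / 2 * η', by positivity, c', hc', fun C => ?_⟩
  obtain ⟨n₀, hn₀⟩ := hE C
  refine ⟨max n₀ M', fun L₀ L₁ L₂ hL₀ hL₁ hL₂ D hDlog hD₁ hD₂ a₀ b₀ a₁ b₁ a₂ b₂
    ha₀ hb₀ ha₁ hb₁ ha₂ hb₂ dec₀ dec₁ dec₂ => ?_⟩
  have hL₀n₀ : n₀ ≤ L₀ := le_trans (le_max_left _ _) hL₀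
  have hL₁M : M' ≤ L₁ := le_trans (le_max_right _ _) hL₁
  have hL₂M : M' ≤ L₂ := le_trans (le_max_right _ _) hL₂
  -- the three events
  let E₀ : (Fin (L₀ + (L₁ + L₂)) → Bool) → Prop := fun u =>
    dec₀ (a₀ u) (b₀ u) % 3 = wt (fun i : Fin L₀ => u (Fin.castAdd (L₁ + L₂) i)) % 3
  let E₁ : (Fin (L₀ + (L₁ + L₂)) → Bool) → Prop := fun u =>
    dec₁ (a₁ u) (b₁ u) % 3 = wt (fun j : Fin L₁ => u (Fin.natAdd L₀ (Fin.castAdd L₂ j))) % 3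
  let E₂ : (Fin (L₀ + (L₁ + L₂)) → Bool) → Prop := fun u =>
    dec₂ (a₂ u) (b₂ u) % 3 = wt (fun j : Fin L₂ => u (Fin.natAdd L₀ (Fin.natAdd L₁ j))) % 3
  -- blocks of `x ++ z`
  have hz₁ : ∀ (x : Fin L₀ → Bool) (z : Fin (L₁ + L₂) → Bool),
      (fun j : Fin L₁ => Fin.append x z (Fin.natAdd L₀ (Fin.castAdd L₂ j))) =
        fun j : Fin L₁ => z (Fin.castAdd L₂ j) := by
    intro x z; funext j; simp [Fin.append_right]
  have hz₂ : ∀ (x : Fin L₀ → Bool) (z : Fin (L₁ + L₂) → Bool),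
      (fun j : Fin L₂ => Fin.append x z (Fin.natAdd L₀ (Fin.natAdd L₁ j))) =
        fun j : Fin L₂ => z (Fin.natAdd L₁ j) := by
    intro x z; funext j; simp [Fin.append_right]
  -- row counts of the first event
  let A : (Fin L₀ → Bool) → ℕ := fun x =>
    (univ.filter fun z : Fin (L₁ + L₂) → Bool => E₀ (Fin.append x z)).card
  -- (1) fibrewise `elimHard` on the first block
  have hstep1 : η₀ * (2 : ℝ) ^ (L₀ + (L₁ + L₂)) ≤ ((∑ x : Fin L₀ → Bool, A x : ℕ) : ℝ) := by
    have hcols : ∀ z : Fin (L₁ + L₂) → Bool, η₀ * (2 : ℝ) ^ L₀ ≤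
        ((univ.filter fun x : Fin L₀ → Bool => E₀ (Fin.append x z)).card : ℝ) := by
      intro z
      have h := hn₀ L₀ hL₀n₀ (fun x => a₀ (Fin.append x z)) (fun x => b₀ (Fin.append x z))
        (lowDeg_mono hDlog (comp_append_left_mem_lowDeg ha₀ z))
        (lowDeg_mono hDlog (comp_append_left_mem_lowDeg hb₀ z)) dec₀
      have hset : (univ.filter fun x : Fin L₀ → Bool =>
          dec₀ (a₀ (Fin.append x z)) (b₀ (Fin.append x z)) % 3 = wt x % 3) =
          univ.filter fun x : Fin L₀ → Bool => E₀ (Fin.append x z) := by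
        refine filter_congr fun x _ => ?_
        simp only [E₀, left_of_append]
      rw [hset] at h
      exact h
    have htot : ((univ.filter E₀).card : ℝ) = ((∑ x : Fin L₀ → Bool, A x : ℕ) : ℝ) := by
      rw [card_filter_eq_sum_left E₀]
    have htot' : ((univ.filter E₀).card : ℝ) = ∑ z : Fin (L₁ + L₂) → Bool,
        ((univ.filter fun x : Fin L₀ → Bool => E₀ (Fin.append x z)).card : ℝ) := by
      rw [card_filter_eq_sum_right E₀]; push_cast; rfl
    rw [← htot, htot']
    calc η₀ * (2 : ℝ) ^ (L₀ + (L₁ + L₂)) = ∑ _z : Fin (L₁ + L₂) → Bool, η₀ * (2 : ℝ) ^ L₀ := by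
          rw [sum_const, card_univ, Fintype.card_fun, Fintype.card_bool, Fintype.card_fin,
            nsmul_eq_mul, pow_add]
          push_cast; ring
      _ ≤ _ := sum_le_sum fun z _ => hcols z
  -- (2) Markov over the rows
  have hA_le : ∀ x, (A x : ℝ) ≤ (2 : ℝ) ^ (L₁ + L₂) := by
    intro x
    have : A x ≤ (univ : Finset (Fin (L₁ + L₂) → Bool)).card := card_le_card (filter_subset _ _)
    rw [card_univ, Fintype.card_fun, Fintype.card_bool, Fintype.card_fin] at this
    exact_mod_cast this
  have hc₀ : (Fintype.card (Fin L₀ → Bool) : ℝ) = (2 : ℝ) ^ L₀ := by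
    rw [Fintype.card_fun, Fintype.card_bool, Fintype.card_fin]; push_cast; ring
  have hA_sum : η₀ * (Fintype.card (Fin L₀ → Bool) : ℝ) * (2 : ℝ) ^ (L₁ + L₂) ≤
      ∑ x, (A x : ℝ) := by
    rw [hc₀]
    have := hstep1
    push_cast at this
    calc η₀ * (2 : ℝ) ^ L₀ * (2 : ℝ) ^ (L₁ + L₂) = η₀ * (2 : ℝ) ^ (L₀ + (L₁ + L₂)) := by
          rw [pow_add]; ring
      _ ≤ ∑ x, (A x : ℝ) := this
  have hGx := card_filter_ge_of_sum_ge (fun x => (A x : ℝ)) ((2 : ℝ) ^ (L₁ + L₂)) η₀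
    (by positivity) hA_le hA_sum
  rw [hc₀] at hGx
  -- (3) in a good row: a dense level set of `(a₀, b₀)(x, ·)` and the relative two-block theorem
  have hrow : ∀ x ∈ ((univ : Finset (Fin L₀ → Bool)).filter
      fun x => η₀ / 2 * (2 : ℝ) ^ (L₁ + L₂) ≤ (A x : ℝ)), η' * (2 : ℝ) ^ (L₁ + L₂) ≤
      ((univ.filter fun z : Fin (L₁ + L₂) → Bool =>
        E₀ (Fin.append x z) ∧ E₁ (Fin.append x z) ∧ E₂ (Fin.append x z)).card : ℝ) := by
    intro x hx
    rw [mem_filter] at hx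
    have hAx := hx.2
    have hAeq : A x = ∑ p ∈ (univ : Finset (ZMod 2 × ZMod 2)).filter
        (fun p => dec₀ p.1 p.2 % 3 = wt x % 3),
        (univ.filter fun z : Fin (L₁ + L₂) → Bool =>
          a₀ (Fin.append x z) = p.1 ∧ b₀ (Fin.append x z) = p.2).card := by
      have h := card_eq_sum_card_fiberwise
        (s := univ.filter fun z : Fin (L₁ + L₂) → Bool => E₀ (Fin.append x z))
        (t := (univ : Finset (ZMod 2 × ZMod 2)).filter fun p => dec₀ p.1 p.2 % 3 = wt x % 3)
        (f := fun z => (a₀ (Fin.append x z), b₀ (Fin.append x z))) (fun z hz => by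
          rw [Finset.mem_coe, mem_filter] at hz
          rw [Finset.mem_coe, mem_filter]
          refine ⟨mem_univ _, ?_⟩
          have := hz.2
          simp only [E₀, left_of_append] at this
          exact this)
      change (univ.filter fun z : Fin (L₁ + L₂) → Bool => E₀ (Fin.append x z)).card = _
      rw [h]
      refine sum_congr rfl fun p hp => ?_
      rw [mem_filter] at hp
      congr 1
      ext z
      simp only [mem_filter, mem_univ, true_and, Prod.ext_iff, E₀, left_of_append]
      constructor
      · rintro ⟨-, h1, h2⟩; exact ⟨h1, h2⟩
      · rintro ⟨h1, h2⟩; refine ⟨?_, h1, h2⟩; rw [h1, h2]; exact hp.2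
    have hbig : ∃ p : ZMod 2 × ZMod 2, dec₀ p.1 p.2 % 3 = wt x % 3 ∧
        η₀ / 10 * (2 : ℝ) ^ (L₁ + L₂) ≤
        ((univ.filter fun z : Fin (L₁ + L₂) → Bool =>
          a₀ (Fin.append x z) = p.1 ∧ b₀ (Fin.append x z) = p.2).card : ℝ) := by
      by_contra hno
      push Not at hno
      have hle : (A x : ℝ) ≤ ∑ _p ∈ (univ : Finset (ZMod 2 × ZMod 2)).filter
          (fun p => dec₀ p.1 p.2 % 3 = wt x % 3), η₀ / 10 * (2 : ℝ) ^ (L₁ + L₂) := by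
        rw [hAeq]; push_cast
        exact sum_le_sum fun p hp => le_of_lt (hno p (mem_filter.1 hp).2)
      rw [sum_const, nsmul_eq_mul] at hle
      have hc4 : (((univ : Finset (ZMod 2 × ZMod 2)).filter
          (fun p => dec₀ p.1 p.2 % 3 = wt x % 3)).card : ℝ) ≤ 4 := by
        have : ((univ : Finset (ZMod 2 × ZMod 2)).filter
            (fun p => dec₀ p.1 p.2 % 3 = wt x % 3)).card ≤
            (univ : Finset (ZMod 2 × ZMod 2)).card := card_le_card (filter_subset _ _)
        have h4 : (univ : Finset (ZMod 2 × ZMod 2)).card = 4 := by simp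
        rw [h4] at this; exact_mod_cast this
      have hmul : (((univ : Finset (ZMod 2 × ZMod 2)).filter
          (fun p => dec₀ p.1 p.2 % 3 = wt x % 3)).card : ℝ) * (η₀ / 10 * (2 : ℝ) ^ (L₁ + L₂)) ≤
            4 * (η₀ / 10 * (2 : ℝ) ^ (L₁ + L₂)) :=
        mul_le_mul_of_nonneg_right hc4 (by positivity)
      have hpos : (0 : ℝ) < η₀ * (2 : ℝ) ^ (L₁ + L₂) := by positivity
      linarith
    obtain ⟨⟨α, β⟩, hpr, hdense⟩ := hbig
    -- the level set as a degree-`2D` support on the `(L₁ + L₂)`-cube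
    have hconst : ∀ c : ZMod 2, (fun _ : Fin (L₁ + L₂) → Bool => c) ∈ lowDeg (ZMod 2) (L₁ + L₂) D := by
      intro c
      have h1 : (1 : CubeFn (ZMod 2) (L₁ + L₂)) ∈ lowDeg (ZMod 2) (L₁ + L₂) D := by
        rw [← mono_empty]; exact mono_mem_lowDeg (by simp)
      have : (fun _ : Fin (L₁ + L₂) → Bool => c) = c • (1 : CubeFn (ZMod 2) (L₁ + L₂)) := by
        funext u; simp
      rw [this]; exact Submodule.smul_mem _ c h1
    set v : CubeFn (ZMod 2) (L₁ + L₂) := ((fun z => a₀ (Fin.append x z)) + (fun _ => α + 1)) *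
      ((fun z => b₀ (Fin.append x z)) + (fun _ => β + 1)) with hv
    have hvdeg : v ∈ lowDeg (ZMod 2) (L₁ + L₂) (D + D) :=
      mul_mem_lowDeg_add (Submodule.add_mem _ (comp_append_right_mem_lowDeg ha₀ x) (hconst _))
        (Submodule.add_mem _ (comp_append_right_mem_lowDeg hb₀ x) (hconst _))
    have hv_iff : ∀ z, v z ≠ 0 ↔ a₀ (Fin.append x z) = α ∧ b₀ (Fin.append x z) = β := by
      intro z
      simp only [hv, Pi.mul_apply, Pi.add_apply, mul_ne_zero_iff]
      rw [← add_assoc, ← add_assoc, zmod2_add_add_one_ne_zero_iff4, zmod2_add_add_one_ne_zero_iff4]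
    have hdeg2 : ∀ {P : CubeFn (ZMod 2) (L₀ + (L₁ + L₂))}, P ∈ lowDeg (ZMod 2) (L₀ + (L₁ + L₂)) D →
        (fun z => P (Fin.append x z)) ∈ lowDeg (ZMod 2) (L₁ + L₂) (D + D) := fun hP =>
      lowDeg_mono (by omega) (comp_append_right_mem_lowDeg hP x)
    have hsupp : (univ.filter fun z : Fin (L₁ + L₂) → Bool => v z ≠ 0) =
        univ.filter fun z : Fin (L₁ + L₂) → Bool =>
          a₀ (Fin.append x z) = α ∧ b₀ (Fin.append x z) = β :=
      filter_congr fun z _ => hv_iff z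
    have hrel := hR L₁ L₂ hL₁M hL₂M (D + D) hD₁ hD₂ v _ _ _ _ hvdeg (hdeg2 ha₁) (hdeg2 hb₁)
      (hdeg2 ha₂) (hdeg2 hb₂) dec₁ dec₂ (by rw [hsupp]; exact hdense)
    refine hrel.trans ?_
    have hsub : (univ.filter fun z : Fin (L₁ + L₂) → Bool => v z ≠ 0 ∧
        dec₁ (a₁ (Fin.append x z)) (b₁ (Fin.append x z)) % 3 =
          wt (fun j : Fin L₁ => z (Fin.castAdd L₂ j)) % 3 ∧
        dec₂ (a₂ (Fin.append x z)) (b₂ (Fin.append x z)) % 3 =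
          wt (fun j : Fin L₂ => z (Fin.natAdd L₁ j)) % 3) ⊆
        univ.filter fun z : Fin (L₁ + L₂) → Bool =>
          E₀ (Fin.append x z) ∧ E₁ (Fin.append x z) ∧ E₂ (Fin.append x z) := by
      intro z hz
      rw [mem_filter] at hz ⊢
      obtain ⟨hα, hβ⟩ := (hv_iff z).1 hz.2.1
      refine ⟨mem_univ _, ?_, ?_, ?_⟩
      · simp only [E₀, left_of_append]; rw [hα, hβ]; exact hpr
      · simp only [E₁, hz₁]; exact hz.2.2.1
      · simp only [E₂, hz₂]; exact hz.2.2.2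
    exact_mod_cast card_le_card hsub
  -- (4) sum over the good rows
  have htot : ((univ.filter fun u : Fin (L₀ + (L₁ + L₂)) → Bool => E₀ u ∧ E₁ u ∧ E₂ u).card : ℝ) =
      ∑ x : Fin L₀ → Bool, ((univ.filter fun z : Fin (L₁ + L₂) → Bool =>
        E₀ (Fin.append x z) ∧ E₁ (Fin.append x z) ∧ E₂ (Fin.append x z)).card : ℝ) := by
    rw [card_filter_eq_sum_left (fun u => E₀ u ∧ E₁ u ∧ E₂ u)]; push_cast; rfl
  change η₀ / 2 * η' * (2 : ℝ) ^ (L₀ + (L₁ + L₂)) ≤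
    ((univ.filter fun u : Fin (L₀ + (L₁ + L₂)) → Bool => E₀ u ∧ E₁ u ∧ E₂ u).card : ℝ)
  rw [htot]
  calc η₀ / 2 * η' * (2 : ℝ) ^ (L₀ + (L₁ + L₂))
      = (η₀ / 2 * (2 : ℝ) ^ L₀) * (η' * (2 : ℝ) ^ (L₁ + L₂)) := by rw [pow_add]; ring
    _ ≤ (((univ : Finset (Fin L₀ → Bool)).filter
          fun x => η₀ / 2 * (2 : ℝ) ^ (L₁ + L₂) ≤ (A x : ℝ)).card : ℝ) * (η' * (2 : ℝ) ^ (L₁ + L₂)) :=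
        mul_le_mul_of_nonneg_right hGx (by positivity)
    _ = ∑ _x ∈ ((univ : Finset (Fin L₀ → Bool)).filter
          fun x => η₀ / 2 * (2 : ℝ) ^ (L₁ + L₂) ≤ (A x : ℝ)), η' * (2 : ℝ) ^ (L₁ + L₂) := by
        rw [sum_const, nsmul_eq_mul]
    _ ≤ ∑ x ∈ ((univ : Finset (Fin L₀ → Bool)).filter
          fun x => η₀ / 2 * (2 : ℝ) ^ (L₁ + L₂) ≤ (A x : ℝ)),
          ((univ.filter fun z : Fin (L₁ + L₂) → Bool =>
            E₀ (Fin.append x z) ∧ E₁ (Fin.append x z) ∧ E₂ (Fin.append x z)).card : ℝ) :=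
        sum_le_sum hrow
    _ ≤ ∑ x : Fin L₀ → Bool, ((univ.filter fun z : Fin (L₁ + L₂) → Bool =>
          E₀ (Fin.append x z) ∧ E₁ (Fin.append x z) ∧ E₂ (Fin.append x z)).card : ℝ) :=
        sum_le_sum_of_subset_of_nonneg (filter_subset _ _) fun _ _ _ => Nat.cast_nonneg _

end Summit.QuantumAdvantage.AdviceFreeQNC0
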